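import Literature.MathematicalPhysics.QuantumLattice.KomaTasakiSSB
import HarnessLib

/-!
# Barrier: long-range order without symmetry breaking forces low-lying states (Horsch–von der Linden; Koma–Tasaki)

Barrier catalogue `Literature/Barriers/HubbardSuperconductivity/` (D-0021), entry
`LROForcesLowLyingStates`, for the summit `HubbardSuperconductivity` (`d_{x²-y²}` pair-field
long-range order, `liminf |Λ|⁻² ⟨ψ_Λ, Δ_d† Δ_d ψ_Λ⟩ > 0`, of EVERY sequence of fixed-particle-number
sector ground states `ψ_Λ` of the pure repulsive Hubbard model on even square tori).

## What is vendored (as printed)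

* T. Koma, H. Tasaki, J. Stat. Phys. **76** (1994) 745–803 (`KomaTasaki1994`, held as
  `paper:arxiv-cond-mat_9708132`). §2.2, **Theorem 2.2 (Horsch–von der Linden)**: finite lattice
  `Λ`, `N` sites, `H_Λ = Σ_x h_x`, order operator `O_Λ = Σ_x o_x` with self-adjoint `o_x`,
  `‖h_x‖ ≤ h`, `‖o_x‖ ≤ o`, `[o_x, o_y] = 0`, `[h_x, o_y] = 0` unless `y ∈ S_x`, `|S_x| ≤ r`;
  `Φ_Λ` an eigenstate of `H_Λ` (eigenvalue `E_Λ`) with "obscured symmetry breaking"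
  `⟨O_Λ⟩ = 0` (2.6) and `⟨(O_Λ)²⟩ ≥ (μ o N)²`, `0 < μ ≤ 1` (2.7). Then `Ψ_Λ = O_Λ Φ_Λ/‖O_Λ Φ_Λ‖`
  satisfies `N⁻¹ |(Ψ_Λ, H_Λ Ψ_Λ) - E_Λ| ≤ c₀ N⁻²`, `c₀ = 2 r² h μ⁻²` (2.9), and "when `Φ_Λ` is the
  ground state … there exists an eigenstate `Φ_Λ^{(1)}` of `H_Λ` whose energy satisfies
  `E_Λ^{(1)} - E_Λ ≤ c₀/N`" (2.10). Proof as printed: the double-commutator identity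
  `|(Ψ, HΨ) - E| = |⟨[[O, H], O]⟩| / (2‖OΦ‖²) ≤ ‖[[O, H], O]‖/(2‖OΦ‖²) ≤ 4r²ho²N/(2(μoN)²)`, then
  `Ψ ⊥ Φ` by (2.6) and the variational principle.
  §2.3 (2.12)–(2.18): with a `U(1)` generator `C_Λ`, `[H_Λ, C_Λ] = 0`, order operators
  `[O^{(1)}, C] = -iO^{(2)}`, `[O^{(2)}, C] = iO^{(1)}` (2.14), a simultaneous eigenstate `Φ_Λ` of
  `H_Λ` and `C_Λ` has `⟨O^{(1)}⟩ = ⟨O^{(2)}⟩ = 0` "automatically" (2.18): "the state `Φ_Λ` have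
  vanishing order parameters". Theorem 2.3 (`U(1)` only): the states `Ψ^{(M)} = (O^±)^{|M|}Φ/‖…‖`
  have `N⁻¹|(Ψ^{(M)}, HΨ^{(M)}) - E| ≤ c₁|M|/N`; Theorem 2.4 and Corollary 2.10 (extra
  `U(1) × ℤ₂` symmetry): eigenstates `Φ^{(M)}`, mutually orthogonal, with
  `E^{(M)} - E^{(0)} ≤ c₃ M²/N` — "ever increasing numbers of low-lying eigenstates whose
  excitation energies are bounded from above by a constant times `N⁻¹`" (§2.6). Remark after
  Cor. 2.10: from Theorem 2.3 alone one only gets excitation energies "of order 1", which "carries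
  no nontrivial information about the low-lying spectrum". §3.4 (lattice electrons): for a
  Hamiltonian commuting with `N_e` (e.g. the Hubbard model) singlet-pair order operators
  `o_x^{(1)} = ½(p_x c*_{x↑}c*_{x↓} - p̄_x c_{x↑}c_{x↓})`, `o_x^{(2)} = …` satisfy the conditions of
  Theorem 2.3 with `C_Λ = (N_e - N)/2`; "As in the Bose–Einstein condensation problem, the ground
  states [with explicit symmetry breaking] do not conserve particle numbers. Except for half-filled
  models with special Hamiltonians, the models do not have a `U(1) × ℤ₂` symmetry necessary to
  apply Theorem 2.4"; other pairings (pairs of sites as "sites") "with some extra care"; the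
  fermionic (non-tensor-product) Hilbert space "causes no problem for proving our 'low-lying
  states' theorems since we only make use of some commutation relations".
* P. Horsch, W. von der Linden, Z. Phys. B **72** (1988) 181–193 (`HorschVonDerLinden1988`): the
  original of Theorem 2.2 (cited through KT §2.2 and [Tasaki2019Tower, §1]).
* H. Tasaki, J. Stat. Phys. **174** (2019) 735–761 (`Tasaki2019Tower`, held as
  `paper:arxiv-1807.05847`), §1: "such a ground state with LRO but without SSB is inevitably
  accompanied by a series of low-lying energy eigenstates … The number of such low energy
  eigenstates increases indefinitely as the system size grows … 'Anderson's tower of states' …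
  this picture applies universally to almost any quantum many-body systems exhibiting LRO in
  which the Hamiltonian and the order operator do not commute with each other. Examples include
  antiferromagnetism, superconductivity, Bose–Einstein condensate"; Theorem 3.1 (assumptions
  (A1)–(A5), `U(1)` symmetry only, order densities acting on one site) and §3.3: "there are
  `O(√V)` distinct low-lying energy eigenstates", upper bound scaling `M²/V` (3.11); §3.2: "For the
  moment the existence of LRO associated with spontaneous breakdown of continuous symmetry can be
  proved only by using the reflection positivity method".
* M. B. Hastings, T. Koma, CMP **265** (2006) 781–804 (`HastingsKoma2006`, held as
  `paper:arxiv-math-ph_0507008`), Theorem 2.8 (clustering of bosonic correlations, spin AND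
  lattice-fermion systems, `H_Λ = Σ_X h_X` with exponentially decaying `h_X`): under a uniform
  spectral gap `ΔE > 0` above the ground-state sector,
  `|ω(A_X B_Y) - ½[ω(A_X P₀ B_Y) + ω(B_Y P₀ A_X)]| ≤ Const · exp[-μ̃ dist(X, Y)]`.
* T. Koma, arXiv:2005.04548 (`Koma2020GapStability`), Theorem 2.4: for charge-conserving lattice
  fermions `H_s = H₀ + sV`, `H₀` quasi-free with Fermi energy in a spectral gap of the one-body
  operator, `|s| ≤ s₀`: "(i) The ground state … is non-degenerate. (ii) The spectral gap … is
  greater than a positive constant which is independent of the size `|Λ|`".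

Lean rendering. The tree already vendors KT's finite-volume theorems as named facts in
`Literature/MathematicalPhysics/QuantumLattice/KomaTasakiSSB.lean`
(`Literature.MathematicalPhysics.QuantumLattice.KomaTasaki.horschVonDerLinden`, `horschVonDerLinden_eigenstate`, `theorem_2_3`,
`theorem_2_4`, with the abstract `U1System`); they are imported, not restated. The headline
`LROForcesLowLyingStates` is Theorem 2.2 (both parts) := `horschVonDerLinden ∧
horschVonDerLinden_eigenstate`. Both parts of Theorem 2.2 are now PROVED in `KomaTasakiSSB.lean`
(`horschVonDerLinden_holds`: double-commutator identity, locality of `[[O, H], O]`, norm bound;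
`horschVonDerLinden_eigenstate_holds`: `H`-invariance of `Φ^⊥` and Rayleigh-quotient
minimisation), so the barrier is a THEOREM: `LROForcesLowLyingStates_holds`. Also proved here:
the unfolding, the gap form of the obstruction (`LROForcesLowLyingStates.gap_le`, and its
unconditional form `gap_le_of_lro`: under (2.6)–(2.7) for a ground state, any `Δ` separating the
rest of the spectrum restricted to `Φ^⊥` satisfies `Δ ≤ c₀/N`), and KT (2.18) for both Hermitian
order operators of a `U1System` (`inner_order_eq_zero_of_eigen_C`: vanishing order parameters in
every `C`-eigenstate).

## Narrowing (barrier audit 2026-08-15, appended; all proved)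

The audit question was whether the `technique_class:` tokens of the headline
(`unique-gapped-ground-state`, `spectral-gap-stability`, `gapped-phase-perturbation-theory`,
`exponential-clustering`, `Perron-Frobenius-uniqueness`) are covered by the printed argument. They
are covered only in their CHARGE-SECTOR (Fock-space) reading: KT's trial vector `O^{(1)}Φ` lies in
the two adjacent charge sectors and is orthogonal to the whole sector of `Φ`, so Theorem 2.2 forces
low-lying states in `N_e ± 2` and is silent about the spectrum of `H_Λ` restricted to the sector of
`Φ` (and about the odd sectors `N_e ± 1`). The appended block makes this a theorem and removes the
ground-state hypothesis of (2.10):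

* `exists_eigenvector_mem_le_rayleigh` — Rayleigh on an `H`-invariant subspace `K` of a
  finite-dimensional space: an eigenvector in `K` below the Rayleigh quotient of any `v ∈ K`
  (the argument of `horschVonDerLinden_eigenstate_holds`, with `Φ^⊥` replaced by `K`).
* `orderPlus_add_orderMinus_apply` (`O⁺Φ + O⁻Φ = 2O^{(1)}Φ`), `C_hamiltonian_apply` (`H` preserves
  every eigenspace of `C`), `inner_sector_order_zero_apply_eq_zero` (`⟨v, O^{(1)}Φ⟩ = 0` whenever
  `Cv = cv`, `CΦ = cΦ`: the variational input of Theorem 2.2 carries no in-sector information).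
* `LROForcesLowLyingStatesNarrow` (the sharpened barrier) with `LROForcesLowLyingStatesNarrow_holds`:
  for every `U1System`, every LRO eigenstate `Φ` (KT iv), `IsLROEigenstate`) with `CΦ = cΦ` — NO
  ground-state hypothesis — there is an eigenvector `Φ₁ ⊥ Φ` of `H_Λ` with
  `CΦ₁ = (c + 1)Φ₁ ∨ CΦ₁ = (c − 1)Φ₁` and eigenvalue `E₁ ≤ E + 2r²h/(μ²N)`; and
  `LROForcesLowLyingStatesNarrow.min_adjacent_le`: any pair of lower bounds `E₊, E₋` for `H_Λ` on
  the two adjacent sectors has `min E₊ E₋ ≤ E + 2r²h/(μ²N)` (the charge-gap reading).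

Literature read for the audit (page hits in the block's docstring): Tasaki–Watanabe 2021 (charge
gap `Δ_N = E_{N+q} + E_{N−q} − 2E_N` versus ODLRO about ANY sector ground state, lattice fermions
with `q = 2`, and the explicit disclaimer that the neutral/Goldstone gap is not addressed); Koma 2007
(an IN-SECTOR uniform gap excludes `U(1)` order only in fractal dimension `1 ≤ D < 2`); Koma 2021 and
Momoi 1994 (Nambu–Goldstone gaplessness is proved in symmetry-broken infinite-volume states and
needs reflection-positivity/susceptibility input); KT 1994 §3.4 (bond pairing through
non-overlapping dimer "sites"); the tree's `HubbardLSMFilling.lean` (the LSM filling constraint is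
vendored in Fock-space-gap form only).

## Mathlib / tree search

Mathlib: `ContinuousLinearMap`, `LinearMap.IsSymmetric`, inner products; no low-lying-states or
order-operator theory. Tree: `KomaTasakiSSB.lean` (above; `inner_orderPlus_eq_zero` is (2.18) for
`O⁺`), `DWaveSource.lean` (`Literature.MathematicalPhysics.QuantumLattice.dWaveOrderParameter`: KT §1 order parameter with a
symmetry-breaking source, limits `Λ ↑ ℤ²` then `h ↓ 0`), `FinDimSpectrum.lean`
(`Matrix.HasSpectralGap`), `HubbardHubbardModel.lean` (Koma–Tasaki 1992, unrelated).

## References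

* T. Koma, H. Tasaki, J. Stat. Phys. 76 (1994) 745–803, arXiv:cond-mat/9708132: §2.2 Thm 2.2
  (2.6)–(2.10); §2.3 (2.12)–(2.18), Thms 2.3–2.4; §2.6 Cor. 2.10 and Remark; §3.4.
* P. Horsch, W. von der Linden, Z. Phys. B 72 (1988) 181–193.
* H. Tasaki, J. Stat. Phys. 174 (2019) 735–761, arXiv:1807.05847: §1, §3.2, Thm 3.1, §3.3, Thm 3.5.
* M. B. Hastings, T. Koma, Commun. Math. Phys. 265 (2006) 781–804, arXiv:math-ph/0507008: Thm 2.8.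
* T. Koma, *Stability of the spectral gap for lattice fermions*, arXiv:2005.04548: Thm 2.4.
* H. Tasaki, H. Watanabe, Phys. Rev. B 104 (2021) L180501, arXiv:2105.10692 (`TasakiWatanabe2021`):
  Theorem eq. (10), proof (13)–(15), p. 3 "Lattice fermion systems", Discussion p. 5.
* T. Koma, J. Math. Phys. 48 (2007) 023303, arXiv:math-ph/0505022 (`Koma2007`): §1, Definition 1,
  Theorems 2–3 and the lattice-fermion bounds following Theorem 3.
* T. Koma, *Dispersion relations of Nambu–Goldstone modes*, arXiv:2105.04970
  (`Koma2021NGDispersion`): §1, Theorem 2.1, Remark (ii).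
* T. Momoi, J. Phys. Soc. Jpn. 63 (1994) 2507–2510, arXiv:cond-mat/9406077 (`Momoi1994SpinWave`):
  Theorem and its proof.
-/

noncomputable section

open Complex Finset
open scoped InnerProductSpace ComplexConjugate

namespace Literature.Barriers.HubbardSuperconductivity

open Literature.MathematicalPhysics.QuantumLattice.KomaTasaki

universe u v

/-- **BARRIER `LROForcesLowLyingStates` (Horsch–von der Linden 1988; Koma–Tasaki 1994,
Theorem 2.2).** On a finite lattice with `N` sites let `H_Λ = Σ_x h_x`, `O_Λ = Σ_x o_x`
(`o_x` self-adjoint, `‖h_x‖ ≤ h`, `‖o_x‖ ≤ o`, `[o_x, o_y] = 0`, `[h_x, o_y] = 0` unless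
`y ∈ S_x`, `|S_x| ≤ r`), and let `Φ_Λ` be a normalised eigenstate of `H_Λ` (eigenvalue `E_Λ`) with
vanishing order parameter `⟨O_Λ⟩ = 0` and long-range order `⟨O_Λ²⟩ ≥ (μ o N)²`, `0 < μ ≤ 1`
(with KT's tacit `o > 0`, `N ≥ 1`). Then (first part) `Ψ_Λ = O_ΛΦ_Λ/‖O_ΛΦ_Λ‖` is well defined
and `|(Ψ_Λ, H_Λ Ψ_Λ) - E_Λ| ≤ c₀/N`, `c₀ = 2r²hμ⁻²`; (second part) if `Φ_Λ` is a ground state,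
`H_Λ` has an eigenvector orthogonal to `Φ_Λ` with eigenvalue `E^{(1)} ≤ E_Λ + c₀/N`. Stated as the
conjunction of the tree's named facts `horschVonDerLinden` (2.9) and
`horschVonDerLinden_eigenstate` (2.10) of `KomaTasakiSSB.lean`.

technique_class: finite-volume-order-parameter unique-gapped-ground-state spectral-gap-stability gapped-phase-perturbation-theory exponential-clustering Perron-Frobenius-uniqueness
blocks: (a) the naive strengthening of HubbardSuperconductivity to a non-zero anomalous average `⟨ψ_Λ, Δ_d ψ_Λ⟩ ≠ 0` in sector ground states — false identically, since every simultaneous eigenstate of `H_Λ` and of the `U(1)` charge `C_Λ = (N_e - N)/2` has `⟨O^{(1)}⟩ = ⟨O^{(2)}⟩ = 0` for the pair order operators [cite: KomaTasaki1994, §2.3 (2.18) and §3.4] (proved below, `inner_order_eq_zero_of_eigen_C`); (b) every route that would exhibit pair long-range order in a ground state `Φ_Λ` of the number-conserving finite-volume Hamiltonian (on Fock space, chemical potential included in `h_x`) while keeping `Φ_Λ` unique with a spectral gap bounded below uniformly in `N` — e.g. by continuation inside a stable gapped phase of charge-conserving lattice fermions [cite: Koma2020GapStability, Theorem 2.4]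 — because pair LRO at level `μ` forces an orthogonal eigenstate within `c₀/N` of `E_Λ` [cite: KomaTasaki1994, Theorem 2.2 (2.10)] and, with `U(1) × ℤ₂` symmetry, "ever increasing numbers" of them [cite: KomaTasaki1994, §2.6 Corollary 2.10]; equivalently, a uniform gap above a unique ground state makes `ω(A_X B_Y) - ½[ω(A_X P₀ B_Y) + ω(B_Y P₀ A_X)]` decay exponentially in `dist(X, Y)` for bosonic (even) observables of lattice fermions [cite: HastingsKoma2006, Theorem 2.8], and the `P₀`-terms vanish for charge-carrying `A_X = Δ_x†` in a charge eigenstate [cite: KomaTasaki1994, (2.18)], excluding `|Λ|⁻² Σ_{x,y} ω(Δ_x† Δ_y) ≥ const > 0`.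
because: `(Ψ, HΨ) - E = ⟨Φ, [[O, H], O] Φ⟩/(2‖OΦ‖²)` for an eigenstate `Φ` and self-adjoint `O`; locality gives `‖[[O, H], O]‖ ≤ 4r²ho²N` while LRO gives `‖OΦ‖² ≥ (μoN)²`, so the trial state `OΦ/‖OΦ‖`, orthogonal to `Φ` by `⟨O⟩ = 0`, has excitation energy `≤ 2r²h/(μ²N)`, and the variational principle yields the eigenstate [cite: KomaTasaki1994, Theorem 2.2, proof]; `⟨O^{(α)}⟩ = 0` because `O^±` shift the conserved charge by `∓1` [cite: KomaTasaki1994, (2.16)–(2.18)]; "such a ground state with LRO but without SSB is inevitably accompanied by a series of low-lying energy eigenstates … Examples include antiferromagnetism, superconductivity, Bose–Einstein condensate" [cite: Tasaki2019Tower, §1].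
evasions_known: (i) state the order as LRO of the two-point function `⟨O²⟩ ≥ (μoN)²` in symmetric finite-volume ground states — which is what the summit does (Scalapino pair-field LRO) [cite: KomaTasaki1994, §1.1 and §2.3 (2.17)]; (ii) symmetry-breaking field: ground states of `H_Λ - B O_Λ^{(1)}`, limits `Λ ↑ ℤ^d` then `B ↓ 0`, break the symmetry whenever there is LRO (Kaplan–Horsch–von der Linden; Koma–Tasaki) [cite: KomaTasaki1994, §2.5 Remark 2] [cite: Tasaki2019Tower, Theorem 3.5] — the tree's `Literature.MathematicalPhysics.QuantumLattice.dWaveOrderParameter` (`DWaveSource.lean`); (iii) build symmetry-broken infinite-volume ground states with order parameter `≥ √2 μ o` from the low-lying states themselves [cite: KomaTasaki1994, Theorems 2.5 and 2.8] [cite: Tasaki2019Tower, Theorem 3.3]; (iv) gap-stability theorems remain available for reference Hamiltonians that are NOT charge conserving or whose ground state has no LRO (band insulators: [cite: Koma2020GapStability, Theorem 2.4]); none of (i)–(iv) proves LRO — "the existence of LRO associated with spontaneous breakdown of continuous symmetry can be proved only by using the reflection positivity method" [cite: Tasaki2019Tower, §3.2].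
scope_caveats: Theorem 2.2 is a finite-volume statement about ONE trial state `O_ΛΦ_Λ` of the Hamiltonian on the full Hilbert space on which `O_Λ` acts (for pairing, Fock space: `O^±` change the particle number by `±2`), so the low-lying eigenstate lies in a different charge sector and NOTHING is asserted about the gap of `H_Λ` restricted to the fixed-`N_e` sector in which the summit's ground states are taken [cite: KomaTasaki1994, §3.4 ("the ground states do not conserve particle numbers")]; with `U(1)` symmetry alone (the doped Hubbard model: "Except for half-filled models with special Hamiltonians, the models do not have a `U(1) × ℤ₂` symmetry") Theorem 2.3 bounds the tower's energies only by `c₁|M|` = "of order 1", which "carries no nontrivial information about the low-lying spectrum" — the `N⁻¹` tower (Cor. 2.10) needs hypotheses v)–vi) [cite: KomaTasaki1994, §2.6 Remark and §3.4], partially lifted for one-site order densities in [cite: Tasaki2019Tower, Theorem 3.1 (3.9)]; KT's hypotheses tacitly need `o > 0`, `N ≥ 1` (see `KomaTasakiSSB.lean`, design notes); the theorems say nothing about whether LRO holds; [cite: HastingsKoma2006, Theorem 2.8] is an infinite-volume clustering bound under a gap uniform in `Λ`, not a finite-`N` energy estimate; (barrier audit 2026-08-15, see `LROForcesLowLyingStatesNarrow`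 below) of the technique_class tokens above only the CHARGE-SECTOR reading is covered: the forced eigenstate lies in the adjacent charge sectors `C = c ± 1` (`N_e ± 2`) and needs no ground-state hypothesis, so sector (Perron–Frobenius) uniqueness, in-sector (neutral) or odd-sector (`N_e ± 1`) gaps, and clustering or gap-stability arguments built on THOSE gaps are not obstructed by this entry — an in-sector uniform gap is known to exclude pair LRO only in dimension `D < 2` [cite: Koma2007, Thm 3], and the charge-gap form of the obstruction about any sector ground state is [cite: TasakiWatanabe2021, Theorem (10) and Discussion].
status: established (theorems: [cite: KomaTasaki1994, Theorems 2.2–2.4 and Corollary 2.10], [cite: HorschVonDerLinden1988, main theorem (as restated in KomaTasaki1994, Theorem 2.2)], [cite: Tasaki2019Tower, Theorems 3.1, 3.3, 3.5], [cite: HastingsKoma2006, Theorem 2.8]; in the tree Theorem 2.2 — this headline — is PROVED (`LROForcesLowLyingStates_holds`, from `horschVonDerLinden_holds` and `horschVonDerLinden_eigenstate_holds` of `KomaTasakiSSB.lean`), Theorems 2.3–2.4 are named facts, and (2.18) and the gap corollary are proved below)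
[cite: KomaTasaki1994, Theorem 2.2 (2.9)–(2.10)] -/
def LROForcesLowLyingStates : Prop :=
  horschVonDerLinden.{u, v} ∧ horschVonDerLinden_eigenstate.{u, v}

/-- **The barrier is a theorem.** Both parts of KT Theorem 2.2 are proved in
`KomaTasakiSSB.lean` (`horschVonDerLinden_holds`, `horschVonDerLinden_eigenstate_holds`).
[cite: KomaTasaki1994, Theorem 2.2 (2.9)–(2.10)] -/
theorem LROForcesLowLyingStates_holds : LROForcesLowLyingStates.{u, v} :=
  ⟨horschVonDerLinden_holds, horschVonDerLinden_eigenstate_holds⟩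

/-- Unfolding: the barrier is KT Theorem 2.2, parts (2.9) and (2.10), as vendored in
`KomaTasakiSSB.lean`. [cite: KomaTasaki1994, Theorem 2.2] -/
theorem lroForcesLowLyingStates_iff :
    LROForcesLowLyingStates.{u, v} ↔
      horschVonDerLinden.{u, v} ∧ horschVonDerLinden_eigenstate.{u, v} :=
  Iff.rfl

/-- **Gap form of the obstruction** (contrapositive reading of KT (2.10)). Under the hypotheses
of Theorem 2.2 with `Φ` a ground state (variational characterisation `E ≤ ⟨ψ, Hψ⟩` on unit
vectors): if every eigenvector of `H_Λ` orthogonal to `Φ` has eigenvalue `≥ E + Δ` — i.e. `Φ` is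
a unique ground state with spectral gap at least `Δ` — then `Δ ≤ c₀/N = 2r²h/(μ²N)`. A gap
bounded below uniformly in `N` is therefore incompatible with long-range order at fixed `μ > 0`
for large `N`. [cite: KomaTasaki1994, Theorem 2.2 (2.10)] -/
theorem LROForcesLowLyingStates.gap_le (hB : LROForcesLowLyingStates.{u, v})
    {Λ : Type u} [Fintype Λ] [Nonempty Λ] {E : Type v} [NormedAddCommGroup E]
    [InnerProductSpace ℂ E] [FiniteDimensional ℂ E]
    (h o : Λ → E →L[ℂ] E) (supp : Λ → Finset Λ) (r : ℕ) (hbar obar μ : ℝ) (Φ : E) (EΛ Δ : ℝ)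
    (hh : ∀ x, (h x : E →ₗ[ℂ] E).IsSymmetric) (ho : ∀ x, (o x : E →ₗ[ℂ] E).IsSymmetric)
    (hhb : ∀ x, ‖h x‖ ≤ hbar) (hob : ∀ x, ‖o x‖ ≤ obar) (hobar : 0 < obar)
    (hoo : ∀ x y, Commute (o x) (o y)) (hho : ∀ x y, y ∉ supp x → Commute (h x) (o y))
    (hsupp : ∀ x, (supp x).card ≤ r)
    (hΦ : ‖Φ‖ = 1) (hHΦ : (∑ x, h x) Φ = (EΛ : ℂ) • Φ)
    (hgs : ∀ ψ : E, ‖ψ‖ = 1 → EΛ ≤ (⟪ψ, (∑ x, h x) ψ⟫_ℂ).re)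
    (hnosb : ⟪Φ, (∑ x, o x) Φ⟫_ℂ = 0) (hμ : 0 < μ) (hμ1 : μ ≤ 1)
    (hlro : (μ * obar * Fintype.card Λ) ^ 2 ≤ (⟪Φ, (∑ x, o x) ((∑ x, o x) Φ)⟫_ℂ).re)
    (hgap : ∀ (Φ₁ : E) (E₁ : ℝ), Φ₁ ≠ 0 → ⟪Φ, Φ₁⟫_ℂ = 0 → (∑ x, h x) Φ₁ = (E₁ : ℂ) • Φ₁ →
      EΛ + Δ ≤ E₁) :
    Δ ≤ (2 * (r : ℝ) ^ 2 * hbar / μ ^ 2) / Fintype.card Λ := by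
  obtain ⟨Φ₁, E₁, hΦ₁, horth, heig, hE₁⟩ :=
    hB.2 h o supp r hbar obar μ Φ EΛ hh ho hhb hob hobar hoo hho hsupp hΦ hHΦ hgs hnosb hμ hμ1 hlro
  have := hgap Φ₁ E₁ hΦ₁ horth heig
  linarith

/-- **Gap form, unconditional.** Under the hypotheses of KT Theorem 2.2 with `Φ` a ground
state, a spectral gap `Δ` above `Φ` (every eigenvector orthogonal to `Φ` has eigenvalue
`≥ E + Δ`) satisfies `Δ ≤ 2r²h/(μ²N)`: long-range order at level `μ` is incompatible with a gap
bounded below uniformly in `N`. (`LROForcesLowLyingStates.gap_le` fed with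
`LROForcesLowLyingStates_holds`.) [cite: KomaTasaki1994, Theorem 2.2 (2.10)] -/
theorem gap_le_of_lro
    {Λ : Type u} [Fintype Λ] [Nonempty Λ] {E : Type v} [NormedAddCommGroup E]
    [InnerProductSpace ℂ E] [FiniteDimensional ℂ E]
    (h o : Λ → E →L[ℂ] E) (supp : Λ → Finset Λ) (r : ℕ) (hbar obar μ : ℝ) (Φ : E) (EΛ Δ : ℝ)
    (hh : ∀ x, (h x : E →ₗ[ℂ] E).IsSymmetric) (ho : ∀ x, (o x : E →ₗ[ℂ] E).IsSymmetric)
    (hhb : ∀ x, ‖h x‖ ≤ hbar) (hob : ∀ x, ‖o x‖ ≤ obar) (hobar : 0 < obar)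
    (hoo : ∀ x y, Commute (o x) (o y)) (hho : ∀ x y, y ∉ supp x → Commute (h x) (o y))
    (hsupp : ∀ x, (supp x).card ≤ r)
    (hΦ : ‖Φ‖ = 1) (hHΦ : (∑ x, h x) Φ = (EΛ : ℂ) • Φ)
    (hgs : ∀ ψ : E, ‖ψ‖ = 1 → EΛ ≤ (⟪ψ, (∑ x, h x) ψ⟫_ℂ).re)
    (hnosb : ⟪Φ, (∑ x, o x) Φ⟫_ℂ = 0) (hμ : 0 < μ) (hμ1 : μ ≤ 1)
    (hlro : (μ * obar * Fintype.card Λ) ^ 2 ≤ (⟪Φ, (∑ x, o x) ((∑ x, o x) Φ)⟫_ℂ).re)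
    (hgap : ∀ (Φ₁ : E) (E₁ : ℝ), Φ₁ ≠ 0 → ⟪Φ, Φ₁⟫_ℂ = 0 → (∑ x, h x) Φ₁ = (E₁ : ℂ) • Φ₁ →
      EΛ + Δ ≤ E₁) :
    Δ ≤ (2 * (r : ℝ) ^ 2 * hbar / μ ^ 2) / Fintype.card Λ :=
  LROForcesLowLyingStates_holds.gap_le h o supp r hbar obar μ Φ EΛ Δ hh ho hhb hob hobar hoo hho
    hsupp hΦ hHΦ hgs hnosb hμ hμ1 hlro hgap

/-! ### Obscured symmetry breaking: vanishing order parameters (KT (2.18)) -/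

section NOSB

variable {Λ : Type u} [Fintype Λ] {E : Type v} [NormedAddCommGroup E] [InnerProductSpace ℂ E]

/-- For a symmetric operator `C` with eigenvector `Φ`, `C Φ = c Φ`, the expectation of any
commutator with `C` vanishes: `⟨Φ, (T C - C T) Φ⟩ = 0` (the eigenvalue is real, or `Φ = 0`).
[folklore] -/
theorem inner_commutator_eq_zero_of_eigen {C : E →L[ℂ] E} (hC : (C : E →ₗ[ℂ] E).IsSymmetric)
    (T : E →L[ℂ] E) {Φ : E} {c : ℂ} (hΦ : C Φ = c • Φ) :
    ⟪Φ, (T * C - C * T) Φ⟫_ℂ = 0 := by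
  by_cases h0 : Φ = 0
  · simp [h0]
  have hc : conj c = c := by
    have h3 : ⟪C Φ, Φ⟫_ℂ = ⟪Φ, C Φ⟫_ℂ := hC Φ Φ
    rw [hΦ, inner_smul_right, inner_smul_left] at h3
    exact mul_left_injective₀ (inner_self_ne_zero.mpr h0) h3
  have h4 : ⟪Φ, C (T Φ)⟫_ℂ = c * ⟪Φ, T Φ⟫_ℂ := by
    have h5 : ⟪C Φ, T Φ⟫_ℂ = ⟪Φ, C (T Φ)⟫_ℂ := hC Φ (T Φ)
    rw [← h5, hΦ, inner_smul_left, hc]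
  have h6 : (T * C - C * T) Φ = T (C Φ) - C (T Φ) := rfl
  rw [h6, inner_sub_right, hΦ, map_smul, inner_smul_right, h4, sub_self]

/-- **KT (2.18): obscured symmetry breaking.** In a `U(1)` system, every eigenvector `Φ` of the
charge `C_Λ` has vanishing order parameters `⟨Φ, O^{(1)} Φ⟩ = ⟨Φ, O^{(2)} Φ⟩ = 0` — from the
commutation relations (2.14) `[O^{(1)}, C] = -iO^{(2)}`, `[O^{(2)}, C] = iO^{(1)}`. In particular
fixed-particle-number ground states of a lattice electron model never show a non-zero anomalous
(pair) average; superconducting order must be read off the two-point function (LRO).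
[cite: KomaTasaki1994, §2.3 (2.14), (2.18) and §3.4] -/
theorem inner_order_eq_zero_of_eigen_C (sys : U1System Λ E) {Φ : E} {c : ℂ}
    (hΦ : sys.C Φ = c • Φ) (α : Fin 2) : ⟪Φ, sys.order α Φ⟫_ℂ = 0 := by
  have h0 : ⟪Φ, (sys.order 0 * sys.C - sys.C * sys.order 0) Φ⟫_ℂ = 0 :=
    inner_commutator_eq_zero_of_eigen sys.isSymmetric_C (sys.order 0) hΦ
  have h1 : ⟪Φ, (sys.order 1 * sys.C - sys.C * sys.order 1) Φ⟫_ℂ = 0 :=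
    inner_commutator_eq_zero_of_eigen sys.isSymmetric_C (sys.order 1) hΦ
  have e0 : sys.order 0 * sys.C - sys.C * sys.order 0 = -(I • sys.order 1) := sys.order_zero_C
  have e1 : sys.order 1 * sys.C - sys.C * sys.order 1 = I • sys.order 0 := sys.order_one_C
  have e0' : (-(I • sys.order 1)) Φ = -(I • sys.order 1 Φ) := rfl
  have e1' : (I • sys.order 0) Φ = I • sys.order 0 Φ := rfl
  rw [e0, e0', inner_neg_right, inner_smul_right, neg_eq_zero, mul_eq_zero] at h0
  rw [e1, e1', inner_smul_right, mul_eq_zero] at h1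
  fin_cases α
  · exact h1.resolve_left I_ne_zero
  · exact h0.resolve_left I_ne_zero

/-- Consequently the raising/lowering order operators also have vanishing expectation in every
charge eigenstate: `⟨Φ, O^± Φ⟩ = 0` (for `O⁺` this is the tree's `inner_orderPlus_eq_zero`).
[cite: KomaTasaki1994, (2.18)] -/
theorem inner_orderMinus_eq_zero_of_eigen_C (sys : U1System Λ E) {Φ : E} {c : ℂ}
    (hΦ : sys.C Φ = c • Φ) : ⟪Φ, sys.orderMinus Φ⟫_ℂ = 0 := by
  have e : sys.orderMinus Φ = sys.order 0 Φ - I • sys.order 1 Φ := rfl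
  rw [e, inner_sub_right, inner_smul_right, inner_order_eq_zero_of_eigen_C sys hΦ 0,
    inner_order_eq_zero_of_eigen_C sys hΦ 1, mul_zero, sub_zero]

end NOSB

/-! ### Narrowing (barrier audit 2026-08-15): the forced low-lying eigenstate lives in the
adjacent charge sectors `C = c ± 1`; nothing is asserted in the sector of `Φ`

All statements below are proved. -/

section Narrow

variable {Λ : Type u} [Fintype Λ] {E : Type v} [NormedAddCommGroup E] [InnerProductSpace ℂ E]

omit [Fintype Λ] in
/-- **Rayleigh on an invariant subspace.** A symmetric operator `H` on a finite-dimensional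
space, restricted to an `H`-invariant subspace `K`, has an eigenvector in `K` whose (real)
eigenvalue is at most the Rayleigh quotient of any non-zero `v ∈ K` (compactness of the sphere
of `K` and `hasEigenvector_of_isLocalExtrOn`, as in `horschVonDerLinden_eigenstate_holds` with
`K = Φ^⊥`). [folklore] -/
theorem exists_eigenvector_mem_le_rayleigh [FiniteDimensional ℂ E] (H : E →L[ℂ] E)
    (hH : ∀ φ ψ : E, ⟪H φ, ψ⟫_ℂ = ⟪φ, H ψ⟫_ℂ) (K : Submodule ℂ E)
    (hinv : ∀ v ∈ K, H v ∈ K) {v : E} (hvK : v ∈ K) (hv : v ≠ 0) :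
    ∃ (w : E) (lam : ℝ), w ≠ 0 ∧ w ∈ K ∧ H w = (lam : ℂ) • w ∧
      lam ≤ (⟪v, H v⟫_ℂ).re / ‖v‖ ^ 2 := by
  have hinv' : ∀ v ∈ K, (H : E →ₗ[ℂ] E) v ∈ K := hinv
  set T : K →ₗ[ℂ] K := (H : E →ₗ[ℂ] E).restrict hinv' with hTdef
  have hT : T.IsSymmetric := by
    intro x y
    rw [Submodule.coe_inner, Submodule.coe_inner, hTdef, LinearMap.coe_restrict_apply,
      LinearMap.coe_restrict_apply]
    exact hH x y
  set ψ' : K := ⟨v, hvK⟩ with hψ'def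
  have hψ'ne : ψ' ≠ 0 := fun h0 => hv (congrArg Subtype.val h0)
  have hψ'norm : ‖ψ'‖ = ‖v‖ := rfl
  haveI : CompleteSpace K := FiniteDimensional.complete ℂ K
  haveI := FiniteDimensional.proper_rclike ℂ K
  have H₁ : IsCompact (Metric.sphere (0 : K) ‖ψ'‖) := isCompact_sphere _ _
  have H₂ : (Metric.sphere (0 : K) ‖ψ'‖).Nonempty := ⟨ψ', by simp⟩
  obtain ⟨x₀, hx₀', hTx₀⟩ :=
    H₁.exists_isMinOn H₂ (hT.toSelfAdjoint).val.reApplyInnerSelf_continuous.continuousOn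
  have hx₀ : ‖x₀‖ = ‖ψ'‖ := by simpa using hx₀'
  have hmin : IsMinOn (hT.toSelfAdjoint).val.reApplyInnerSelf (Metric.sphere 0 ‖x₀‖) x₀ := by
    simpa only [← hx₀] using hTx₀
  have hx₀_ne : x₀ ≠ 0 := by
    intro h0
    rw [h0, norm_zero] at hx₀
    exact hψ'ne (norm_eq_zero.mp hx₀.symm)
  have hev := (hT.toSelfAdjoint).prop.hasEigenvector_of_isLocalExtrOn hx₀_ne
    (Or.inl hmin.localize)
  refine ⟨(x₀ : E), (hT.toSelfAdjoint).val.rayleighQuotient x₀, ?_, x₀.2, ?_, ?_⟩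
  · exact fun h0 => hx₀_ne (Subtype.ext h0)
  · have h1 := hev.apply_eq_smul
    have h2 : (((hT.toSelfAdjoint).val : K →ₗ[ℂ] K) x₀ : E) = H x₀ := rfl
    rw [← h2, h1, Submodule.coe_smul]
    rfl
  · have hle : (hT.toSelfAdjoint).val.reApplyInnerSelf x₀ ≤
        (hT.toSelfAdjoint).val.reApplyInnerSelf ψ' := hmin (by simp [hx₀])
    have hrayψ : (hT.toSelfAdjoint).val.reApplyInnerSelf ψ' = (⟪v, H v⟫_ℂ).re := by
      rw [ContinuousLinearMap.reApplyInnerSelf_apply, RCLike.re_to_complex, Submodule.coe_inner]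
      change (⟪H v, v⟫_ℂ).re = _
      rw [hH]
    rw [ContinuousLinearMap.rayleighQuotient, hx₀, hψ'norm, ← hrayψ]
    gcongr

/-- `O^{(1)} Φ = ½ (O⁺ Φ + O⁻ Φ)`, written as `O⁺Φ + O⁻Φ = 2 O^{(1)}Φ`.
[cite: KomaTasaki1994, (2.15)] -/
theorem orderPlus_add_orderMinus_apply (sys : U1System Λ E) (Φ : E) :
    sys.orderPlus Φ + sys.orderMinus Φ = (2 : ℂ) • sys.order 0 Φ := by
  change sys.order 0 Φ + I • sys.order 1 Φ + (sys.order 0 Φ - I • sys.order 1 Φ) =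
    (2 : ℂ) • sys.order 0 Φ
  rw [two_smul]
  abel

/-- The Hamiltonian preserves every charge sector: `C v = a v ⟹ C (H v) = a (H v)`
((2.12) `[H, C] = 0`). [cite: KomaTasaki1994, (2.12)] -/
theorem C_hamiltonian_apply (sys : U1System Λ E) {v : E} {a : ℂ} (hv : sys.C v = a • v) :
    sys.C (sys.hamiltonian v) = a • sys.hamiltonian v := by
  have h := congrArg (fun T : E →L[ℂ] E => T v) sys.commute_hamiltonian.eq
  change sys.hamiltonian (sys.C v) = sys.C (sys.hamiltonian v) at h
  rw [← h, hv, map_smul]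

/-- **The variational input of Theorem 2.2 carries no in-sector information.** In a `U(1)`
system, for a charge eigenvector `Φ` (`CΦ = cΦ`) the KT trial vector `O^{(1)}Φ` is orthogonal to
the WHOLE charge sector of `Φ` (not only to `Φ`): `⟨v, O^{(1)}Φ⟩ = 0` whenever `Cv = cv`, because
`O^{(1)}Φ = ½(O⁺Φ + O⁻Φ)` with `C O^±Φ = (c ± 1) O^±Φ` ((2.16)). [cite: KomaTasaki1994, (2.16)–(2.18)] -/
theorem inner_sector_order_zero_apply_eq_zero (sys : U1System Λ E) {Φ v : E} {c : ℂ}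
    (hC : sys.C Φ = c • Φ) (hv : sys.C v = c • v) : ⟪v, sys.order 0 Φ⟫_ℂ = 0 := by
  by_cases hv0 : v = 0
  · simp [hv0]
  have hcr : conj c = c := sys.conj_eq_of_eigen_C hv0 hv
  have hp : ⟪v, sys.orderPlus Φ⟫_ℂ = 0 :=
    sys.inner_eq_zero_of_eigen_C hv (sys.C_orderPlus_apply hC) (by
      rw [hcr]; intro h; have h2 : (0 : ℂ) = 1 := by linear_combination h
      exact zero_ne_one h2)
  have hm : ⟪v, sys.orderMinus Φ⟫_ℂ = 0 :=
    sys.inner_eq_zero_of_eigen_C hv (sys.C_orderMinus_apply hC) (by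
      rw [hcr]; intro h; have h2 : (0 : ℂ) = -1 := by linear_combination h
      norm_num at h2)
  have h2 : (2 : ℂ) * ⟪v, sys.order 0 Φ⟫_ℂ = 0 := by
    rw [← inner_smul_right, ← orderPlus_add_orderMinus_apply, inner_add_right, hp, hm, add_zero]
  exact (mul_eq_zero.1 h2).resolve_left two_ne_zero

/-- **NARROWED BARRIER `LROForcesLowLyingStatesNarrow` (barrier audit of
`LROForcesLowLyingStates`, 2026-08-15).** In every Koma–Tasaki `U(1)` system (`U1System`:
`[H_Λ, C_Λ] = 0`, `[O^{(1)}, C] = -iO^{(2)}`, `[O^{(2)}, C] = iO^{(1)}`, hypotheses i)–iii)) and for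
every eigenvector `Φ` of `H_Λ` (eigenvalue `E`) which is a charge eigenvector, `CΦ = cΦ`, with
long-range order (2.17) at level `μ` (`IsLROEigenstate`), there is an eigenvector `Φ₁ ⊥ Φ` of `H_Λ`
with eigenvalue `E₁ ≤ E + 2r²h/(μ²N)` lying in one of the two ADJACENT CHARGE SECTORS:
`CΦ₁ = (c + 1)Φ₁` or `CΦ₁ = (c − 1)Φ₁` (for the pair order operators of KT §3.4,
`C = (N_e − N)/2`: electron number `N_e ± 2`). Compared with the catalogued (2.10)
(`horschVonDerLinden_eigenstate`): (i) the sector of the forced low-lying state is certified — it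
is never the sector of `Φ`, the KT trial vector `O^{(1)}Φ = ½(O⁺Φ + O⁻Φ)` being orthogonal to the
whole `c`-eigenspace of `C` (`inner_sector_order_zero_apply_eq_zero`); (ii) NO ground-state
hypothesis on `Φ` is needed (Rayleigh minimisation inside the `H`-invariant eigenspaces of `C`
replaces the variational principle on `Φ^⊥`), so the statement applies verbatim to the summit's
fixed-`(N_e, S^z)` sector ground states, which need not be Fock-space ground states of `H − μN̂`
for any `μ`. Proved: `LROForcesLowLyingStatesNarrow_holds`; charge-gap reading:
`LROForcesLowLyingStatesNarrow.min_adjacent_le`.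

technique_class: charge-gap / incompressibility at the superconducting filling (an `N`-uniform two-particle charge gap `E₀(N_e+2) + E₀(N_e−2) − 2E₀(N_e) ≥ const`), unique-uniformly-gapped-ground-state-ON-FOCK-SPACE (all charge sectors, chemical potential included), charge-conserving-gapped-phase-continuation-on-Fock-space [cite: Koma2020GapStability, Theorem 2.4], exponential-clustering-of-CHARGED-even-observables-from-a-Fock-space-gap [cite: HastingsKoma2006, Theorem 2.8], finite-volume-anomalous-average; NOT covered, although listed in the catalogued entry's technique_class: (α) "Perron-Frobenius-uniqueness" — uniqueness (or fixed quantum numbers) of the ground state within its `(N_e, S^z)` sector, or on Fock space, carries no gap and is fully compatible with long-range order without symmetry breaking (the finite-volume Heisenberg antiferromagnet: "although the ground state of the quantum antiferromagnets for a finite volume is unique, an infinite-volume ground state of the same model exhibits a spontaneous staggered magnetization" [cite: Koma2021NGDispersion, §1 p. 2]; "Anderson's tower of states" [cite: Tasaki2019Tower, §1]); (β) "unique-gapped-ground-state / spectral-gap-stability / gapped-phase-perturbation-theory" for the Hamiltonian RESTRICTED TO THE SECTOR OF `Φ` (the neutral, in-sector gap), or with gaps assumed only in the ODD sectors `N_e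 ± 1` (one-particle/parity gaps): the forced states live in `N_e ± 2` only; (γ) "exponential-clustering" from an in-sector gap: a uniform gap above the sector ground state of `H_{Λ,N}` inside the fixed-`N` subspace excludes pair long-range order (stretched-exponential decay of `⟨c†_{m↑}c†_{m↓}c_{n↑}c_{n↓}⟩_{0,N}`) only on lattices of (fractal) dimension `1 ≤ D < 2` [cite: Koma2007, Definition 1, Theorem 3 and the lattice-fermion bounds following it]; "a zero temperature analogue of the McBryan–Spencer bound has not yet been obtained" [cite: Koma2007, §1] — in `D = 2` no printed theorem excludes a unique sector ground state with an `L`-uniform in-sector gap AND pair long-range order.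
blocks: exactly the catalogued (a) and (b): anomalous averages in charge eigenstates, and pair long-range order in a unique Fock-space ground state with an `N`-uniform gap — equivalently an `N`-uniform two-particle charge gap at the superconducting filling, by `Δ_N ⟨Ô†Ô⟩ ≤ {A + C|μ_N|}|Λ| + BN` with `Δ_N = E_{N+q} + E_{N−q} − 2E_N`, lattice fermions and the Hubbard model with `ô_x = ĉ_{x↑}ĉ_{x↓}`, `q = 2` [cite: TasakiWatanabe2021, Theorem eq. (10), (11), and p. 3 "Lattice fermion systems"]; it does NOT block routes whose spectral input is in-sector (a gap or a quasi-degeneracy count of `H|_{(N_e,S^z)}` at scale `c/L`, sector uniqueness, odd-sector parity gaps after the shift `H − μ_L N̂`), e.g. route `Summits/HubbardSuperconductivity/HubbardSuperconductivity/Theses/ParityGapRigidity.lean`, whose header uses this entry "not fought".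
because: `O^{(1)} = ½(O⁺ + O⁻)` and `C O^±Φ = (c ± 1) O^±Φ` ((2.16), `C_orderPlus_apply`, `C_orderMinus_apply`), so `2O^{(1)}Φ = O⁺Φ + O⁻Φ` is an orthogonal decomposition into the `H`-invariant eigenspaces `K_± = ker(C − (c ± 1))` (`[H, C] = 0`, `C_hamiltonian_apply`); (2.9) for `O^{(1)}` gives `re⟨O⁺Φ, HO⁺Φ⟩ + re⟨O⁻Φ, HO⁻Φ⟩ ≤ (E + c₀/N)(‖O⁺Φ‖² + ‖O⁻Φ‖²)` (the cross terms vanish), hence one of the two Rayleigh quotients is `≤ E + c₀/N`, and the minimum of the Rayleigh quotient of `H|_{K_±}` over a sphere is attained at an eigenvector (`exists_eigenvector_mem_le_rayleigh`) [cite: KomaTasaki1994, Theorem 2.2 (2.9) and (2.16)]; the in-sector spectrum never enters. That nothing in-sector CAN enter at this generality: the charge-gap inequality "deals with the energy gap between two U(1) invariant ground states (with different fixed particle numbers), while the Goldstone theorem deals with the energy gap between a ground state with broken U(1) symmetry and an excited state above it" [cite: TasakiWatanabe2021, Discussion p. 5]; rigorous Nambu–Goldstone gaplessness (`v_min|p|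 ≤ ΔE ≤ v_max|p|`) is proved above symmetry-BROKEN infinite-volume ground states and "relies on the upper bounds for the susceptibilities which are derived from the reflection positivity"; "For general models, some kind of boundedness about susceptibilities is needed for the existence of a gapless mode", with a two-spin example in which symmetry breaking coexists with a spectral gap [cite: Koma2021NGDispersion, Theorem 2.1 and Remark (ii) p. 6]; the Bijl–Feynman single-mode bound `ε(k) ≤ c|k|` likewise lives in the symmetry-broken state (`B ↓ 0` after `Λ ↑ ∞`) and uses Shastry's model-specific structure-factor inequality [cite: Momoi1994SpinWave, Theorem and its proof].
evasions_known: (i)–(iv) of the catalogued entry; (v) in-sector spectral hypotheses — a bounded number of eigenvalues of `H|_{(N_e,S^z)}` below `E₀ + c/L` (phonon scale), parity/one-particle gaps in `N_e ± 1`, sector-relative clustering after `H − μ_L N̂` with `μ_L = (E(N+1) − E(N−1))/2` — are all compatible with the `N_e ± 2` tower (route `ParityGapRigidity`, header "Barriers"); (vi) the summit's sector ground states need no Fock-space optimality for the obstruction either: conjunct (ii) above removes the ground-state hypothesis of (2.10), and the variational inequalities `⟨Ô(Ĥ − E_N)Ô†⟩ ≥ (E_{N+1} − E_N)⟨ÔÔ†⟩`,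 `⟨Ô†(Ĥ − E_N)Ô⟩ ≥ (E_{N−1} − E_N)⟨Ô†Ô⟩` bound the charge gap about ANY sector ground state [cite: TasakiWatanabe2021, eqs. (13)–(15)].
scope_caveats: (a) finite-volume, abstract `U1System` statement with KT's constant `c₀ = 2r²h/μ²` for the single order operator `O^{(1)}` (hypothesis iv) supplies LRO for both `O^{(1)}, O^{(2)}`; only `O^{(1)}` is used); (b) the bound is informative only when `E` lies within `c₀/N` of the bottom of both adjacent sectors — for a number-conserving `H` without chemical potential one side is trivially low; put `−μ n_x` into `h_x` (then `h = h(μ)`), which the abstract statement allows; (c) with `U(1)` alone nothing is said here about `M`-pair states, `|M| ≥ 2` (KT Theorem 2.3: `O(|M|)`; [cite: Tasaki2019Tower, Theorem 3.1 (3.9)] for one-site densities); (d) for the summit's bond (`d_{x²−y²}`) pair field KT's commuting-densities hypothesis i) needs the regrouping into non-overlapping dimer "sites" of [cite: KomaTasaki1994, §3.4] — `Δ_d` is a signed sum of four perfect-matching sums, one of which carries LRO at level `μ/4` whenever `Δ_d` does at level `μ` (triangle inequality); not formalised here; (e) the statement does not say that the in-sector gap is OPEN: physically a neutral paired state carries an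 Anderson–Bogoliubov mode at energy `≈ 2πc_s/L` and, for `d_{x²−y²}`, nodal quasiparticle pairs, so in-sector gaps are expected at scale `1/L` — but no theorem in the tree or in the literature read derives in-sector low-lying states from pair LRO in `D = 2` ([cite: Koma2007, Theorem 3]: `D < 2` only; [cite: Koma2021NGDispersion, Theorem 2.1]: reflection positivity), so a finite-volume in-sector Goldstone bound for lattice fermions without reflection positivity would be new in either direction; (f) Lieb–Schultz–Mattis-type in-sector constraints (non-integer filling per column) are a different mechanism and are vendored in the tree only in Fock-space-gap form (`Literature.MathematicalPhysics.QuantumLattice.bbdf2019_lsm_filling_hubbardTorus`, whose header excludes "the fixed-`N` sector version").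
status: established (proved here: `LROForcesLowLyingStatesNarrow_holds`, axioms `propext`, `Classical.choice`, `Quot.sound`; it is the sector-localised form of [cite: KomaTasaki1994, Theorem 2.2 (2.10)] without its ground-state hypothesis, obtained from `horschVonDerLinden_holds`)
[cite: KomaTasaki1994, Theorem 2.2 (2.9)–(2.10) and (2.16)] [cite: TasakiWatanabe2021, Theorem eq. (10) and Discussion] [cite: Koma2007, Theorem 3] -/
def LROForcesLowLyingStatesNarrow : Prop :=
  ∀ {Λ : Type u} [Fintype Λ] [Nonempty Λ] {E : Type v} [NormedAddCommGroup E]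
    [InnerProductSpace ℂ E] [FiniteDimensional ℂ E]
    (sys : U1System Λ E) (Φ : E) (EΛ μ : ℝ) (c : ℂ),
    IsLROEigenstate sys Φ EΛ μ → sys.C Φ = c • Φ →
      ∃ (Φ₁ : E) (E₁ : ℝ), Φ₁ ≠ 0 ∧ ⟪Φ, Φ₁⟫_ℂ = 0 ∧
        (sys.C Φ₁ = (c + 1) • Φ₁ ∨ sys.C Φ₁ = (c - 1) • Φ₁) ∧
        sys.hamiltonian Φ₁ = (E₁ : ℂ) • Φ₁ ∧
        E₁ - EΛ ≤ (2 * (sys.r : ℝ) ^ 2 * sys.hbar / μ ^ 2) / Fintype.card Λ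

/-- **Proof of the narrowed barrier**: KT (2.9) for `O^{(1)}` (`horschVonDerLinden_holds`), the
orthogonal decomposition `2O^{(1)}Φ = O⁺Φ + O⁻Φ` into the `H`-invariant eigenspaces
`ker(C − (c ± 1))`, and Rayleigh minimisation inside the eigenspace whose component has the smaller
Rayleigh quotient (`exists_eigenvector_mem_le_rayleigh`). [cite: KomaTasaki1994, Theorem 2.2 and (2.16)] -/
theorem LROForcesLowLyingStatesNarrow_holds : LROForcesLowLyingStatesNarrow.{u, v} := by
  intro Λ _ _ E _ _ _ sys Φ EΛ μ c hΦ hC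
  -- KT Theorem 2.2 (2.9) for the single order operator `O^{(1)}`
  have hoo : ∀ x y, Commute (sys.o 0 x) (sys.o 0 y) := by
    intro x y
    by_cases hxy : x = y
    · subst hxy; exact Commute.refl _
    · exact sys.commute_o x y hxy 0 0
  obtain ⟨hne, hbound⟩ := horschVonDerLinden_holds sys.h (sys.o 0) sys.supp sys.r sys.hbar
    sys.obar μ Φ EΛ sys.isSymmetric_h (sys.isSymmetric_o 0) sys.norm_h_le (sys.norm_o_le 0)
    sys.obar_pos hoo (fun x y hy => sys.commute_h_o x y hy 0) sys.card_supp_le hΦ.norm_eq_one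
    hΦ.eigen_hamiltonian (inner_order_eq_zero_of_eigen_C sys hC 0) hΦ.mu_pos hΦ.mu_le_one hΦ.lro
  set H : E →L[ℂ] E := sys.hamiltonian with hHdef
  set v : E := sys.order 0 Φ with hvdef
  set B : ℝ := EΛ + (2 * (sys.r : ℝ) ^ 2 * sys.hbar / μ ^ 2) / Fintype.card Λ with hBdef
  have hne' : v ≠ 0 := hne
  have hHsym : ∀ φ ψ : E, ⟪H φ, ψ⟫_ℂ = ⟪φ, H ψ⟫_ℂ := fun φ ψ => sys.isSymmetric_hamiltonian φ ψ
  -- (2.9) in the form `re ⟪v, Hv⟫ ≤ B ‖v‖²`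
  have hv_energy : (⟪v, H v⟫_ℂ).re ≤ B * ‖v‖ ^ 2 := by
    have h3 := (abs_sub_le_iff.1 hbound).1
    have hre := re_inner_normalize_apply H v
    have h4 : (⟪v, H v⟫_ℂ).re / ‖v‖ ^ 2 - EΛ ≤
        (2 * (sys.r : ℝ) ^ 2 * sys.hbar / μ ^ 2) / Fintype.card Λ := by
      rw [← hre]; exact h3
    have hvpos : 0 < ‖v‖ ^ 2 := by positivity
    have h5 : (⟪v, H v⟫_ℂ).re / ‖v‖ ^ 2 ≤ B := by
      rw [hBdef]; exact (sub_le_iff_le_add'.1 h4)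
    exact (div_le_iff₀ hvpos).1 h5
  -- the two charge components of `2v = O⁺Φ + O⁻Φ`
  set vp : E := sys.orderPlus Φ with hvpdef
  set vm : E := sys.orderMinus Φ with hvmdef
  have hΦ0 : Φ ≠ 0 := by
    intro h0; have := hΦ.norm_eq_one; rw [h0, norm_zero] at this; exact zero_ne_one this
  have hcr : conj c = c := sys.conj_eq_of_eigen_C hΦ0 hC
  have hCp : sys.C vp = (c + 1) • vp := sys.C_orderPlus_apply hC
  have hCm : sys.C vm = (c - 1) • vm := sys.C_orderMinus_apply hC
  have hCHp : sys.C (H vp) = (c + 1) • H vp := C_hamiltonian_apply sys hCp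
  have hCHm : sys.C (H vm) = (c - 1) • H vm := C_hamiltonian_apply sys hCm
  have hne1 : conj (c + 1) ≠ c - 1 := by
    rw [map_add, map_one, hcr]; intro h
    have h2 : (1 : ℂ) = -1 := by linear_combination h
    norm_num at h2
  have hne2 : conj (c - 1) ≠ c + 1 := by
    rw [map_sub, map_one, hcr]; intro h
    have h2 : (-1 : ℂ) = 1 := by linear_combination h
    norm_num at h2
  have horth : ⟪vp, vm⟫_ℂ = 0 := sys.inner_eq_zero_of_eigen_C hCp hCm hne1
  have hcross1 : ⟪vp, H vm⟫_ℂ = 0 := sys.inner_eq_zero_of_eigen_C hCp hCHm hne1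
  have hcross2 : ⟪vm, H vp⟫_ℂ = 0 := sys.inner_eq_zero_of_eigen_C hCm hCHp hne2
  have hsum : vp + vm = (2 : ℂ) • v := orderPlus_add_orderMinus_apply sys Φ
  -- energy and norm of `vp + vm`
  have hE2 : (⟪vp, H vp⟫_ℂ).re + (⟪vm, H vm⟫_ℂ).re ≤ B * (‖vp‖ ^ 2 + ‖vm‖ ^ 2) := by
    have h1 : ⟪vp + vm, H (vp + vm)⟫_ℂ = ⟪vp, H vp⟫_ℂ + ⟪vm, H vm⟫_ℂ := by
      rw [map_add, inner_add_left, inner_add_right, inner_add_right, hcross1, hcross2]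
      ring
    have h2 : ‖vp + vm‖ ^ 2 = ‖vp‖ ^ 2 + ‖vm‖ ^ 2 := by
      have := norm_add_sq_eq_norm_sq_add_norm_sq_of_inner_eq_zero vp vm horth
      simpa only [sq] using this
    have h2c : conj (2 : ℂ) = 2 := map_ofNat _ 2
    have h3 : ⟪vp + vm, H (vp + vm)⟫_ℂ = (4 : ℂ) * ⟪v, H v⟫_ℂ := by
      rw [hsum, map_smul, inner_smul_left, inner_smul_right, h2c]
      ring
    have hn2 : ‖(2 : ℂ)‖ = 2 := by simp
    have h4 : ‖vp + vm‖ ^ 2 = 4 * ‖v‖ ^ 2 := by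
      rw [hsum, norm_smul, hn2]
      ring
    have h5 : (⟪vp + vm, H (vp + vm)⟫_ℂ).re = 4 * (⟪v, H v⟫_ℂ).re := by
      rw [h3, Complex.mul_re, Complex.re_ofNat, Complex.im_ofNat]
      ring
    rw [← Complex.add_re, ← h1, h5, ← h2, h4]
    linarith [hv_energy]
  -- one of the two components has Rayleigh quotient `≤ B`
  have hpick : ∃ w : E, w ≠ 0 ∧ (sys.C w = (c + 1) • w ∨ sys.C w = (c - 1) • w) ∧
      (⟪w, H w⟫_ℂ).re ≤ B * ‖w‖ ^ 2 := by
    by_cases hp0 : vp = 0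
    · have hm0 : vm ≠ 0 := by
        intro hm0
        apply hne'
        have : (2 : ℂ) • v = 0 := by rw [← hsum, hp0, hm0, add_zero]
        exact (smul_eq_zero.1 this).resolve_left two_ne_zero
      refine ⟨vm, hm0, Or.inr hCm, ?_⟩
      have := hE2; rw [hp0] at this; simpa using this
    by_cases hm0 : vm = 0
    · refine ⟨vp, hp0, Or.inl hCp, ?_⟩
      have := hE2; rw [hm0] at this; simpa using this
    rcases le_or_gt ((⟪vp, H vp⟫_ℂ).re) (B * ‖vp‖ ^ 2) with h | h
    · exact ⟨vp, hp0, Or.inl hCp, h⟩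
    · refine ⟨vm, hm0, Or.inr hCm, ?_⟩
      linarith
  obtain ⟨w, hw0, hCw, hwE⟩ := hpick
  -- Rayleigh minimisation on the charge sector of `w`
  obtain ⟨a, ha⟩ : ∃ a : ℂ, sys.C w = a • w ∧ (a = c + 1 ∨ a = c - 1) := by
    rcases hCw with h | h
    · exact ⟨c + 1, h, Or.inl rfl⟩
    · exact ⟨c - 1, h, Or.inr rfl⟩
  set K : Submodule ℂ E := Module.End.eigenspace (sys.C : E →ₗ[ℂ] E) a with hKdef
  have hmemK : ∀ x : E, x ∈ K ↔ sys.C x = a • x := fun x => by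
    rw [hKdef, Module.End.mem_eigenspace_iff]; rfl
  have hinv : ∀ x ∈ K, H x ∈ K := fun x hx => (hmemK _).2 (C_hamiltonian_apply sys ((hmemK _).1 hx))
  obtain ⟨Φ₁, E₁, hΦ₁0, hΦ₁K, hHΦ₁, hE₁⟩ :=
    exists_eigenvector_mem_le_rayleigh H hHsym K hinv ((hmemK w).2 ha.1) hw0
  have hCΦ₁ : sys.C Φ₁ = a • Φ₁ := (hmemK _).1 hΦ₁K
  refine ⟨Φ₁, E₁, hΦ₁0, ?_, ?_, hHΦ₁, ?_⟩
  · refine sys.inner_eq_zero_of_eigen_C hC hCΦ₁ ?_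
    rw [hcr]
    rcases ha.2 with rfl | rfl
    · intro h; have h2 : (0 : ℂ) = 1 := by linear_combination h
      exact zero_ne_one h2
    · intro h; have h2 : (0 : ℂ) = -1 := by linear_combination h
      norm_num at h2
  · rcases ha.2 with rfl | rfl
    · exact Or.inl hCΦ₁
    · exact Or.inr hCΦ₁
  · have hwpos : 0 < ‖w‖ ^ 2 := by positivity
    have : (⟪w, H w⟫_ℂ).re / ‖w‖ ^ 2 ≤ B := by rw [div_le_iff₀ hwpos]; exact hwE
    rw [hBdef] at this
    linarith

/-- **Charge-gap reading of the narrowed barrier.** Under the same hypotheses, any pair of real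
lower bounds `E₊`, `E₋` for the eigenvalues of `H_Λ` on the adjacent charge sectors `C = c + 1`,
`C = c − 1` satisfies `min E₊ E₋ ≤ E + 2r²h/(μ²N)`: with a chemical potential centring the two
sides this is the `O(1/N)` bound on the two-particle charge gap `E₀(N_e+2) + E₀(N_e−2) − 2E₀(N_e)`
of [cite: TasakiWatanabe2021, Theorem (10)–(11)], here about an arbitrary LRO eigenstate.
[cite: KomaTasaki1994, Theorem 2.2 (2.10)] -/
theorem LROForcesLowLyingStatesNarrow.min_adjacent_le (hN : LROForcesLowLyingStatesNarrow.{u, v})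
    {Λ : Type u} [Fintype Λ] [Nonempty Λ] {E : Type v} [NormedAddCommGroup E]
    [InnerProductSpace ℂ E] [FiniteDimensional ℂ E]
    (sys : U1System Λ E) (Φ : E) (EΛ μ : ℝ) (c : ℂ) (hΦ : IsLROEigenstate sys Φ EΛ μ)
    (hC : sys.C Φ = c • Φ) (Ep Em : ℝ)
    (hp : ∀ (w : E) (e : ℝ), w ≠ 0 → sys.C w = (c + 1) • w → sys.hamiltonian w = (e : ℂ) • w →
      Ep ≤ e)
    (hm : ∀ (w : E) (e : ℝ), w ≠ 0 → sys.C w = (c - 1) • w → sys.hamiltonian w = (e : ℂ) • w →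
      Em ≤ e) :
    min Ep Em - EΛ ≤ (2 * (sys.r : ℝ) ^ 2 * sys.hbar / μ ^ 2) / Fintype.card Λ := by
  obtain ⟨Φ₁, E₁, hΦ₁, _horth, hsec, hH, hE₁⟩ := hN sys Φ EΛ μ c hΦ hC
  rcases hsec with h | h
  · have := hp Φ₁ E₁ hΦ₁ h hH
    have := min_le_left Ep Em
    linarith
  · have := hm Φ₁ E₁ hΦ₁ h hH
    have := min_le_right Ep Em
    linarith

/-- Unconditional form of the charge-gap reading (`min_adjacent_le` fed with
`LROForcesLowLyingStatesNarrow_holds`). [cite: KomaTasaki1994, Theorem 2.2 (2.10)] -/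
theorem min_adjacent_le_of_lro
    {Λ : Type u} [Fintype Λ] [Nonempty Λ] {E : Type v} [NormedAddCommGroup E]
    [InnerProductSpace ℂ E] [FiniteDimensional ℂ E]
    (sys : U1System Λ E) (Φ : E) (EΛ μ : ℝ) (c : ℂ) (hΦ : IsLROEigenstate sys Φ EΛ μ)
    (hC : sys.C Φ = c • Φ) (Ep Em : ℝ)
    (hp : ∀ (w : E) (e : ℝ), w ≠ 0 → sys.C w = (c + 1) • w → sys.hamiltonian w = (e : ℂ) • w →
      Ep ≤ e)
    (hm : ∀ (w : E) (e : ℝ), w ≠ 0 → sys.C w = (c - 1) • w → sys.hamiltonian w = (e : ℂ) • w →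
      Em ≤ e) :
    min Ep Em - EΛ ≤ (2 * (sys.r : ℝ) ^ 2 * sys.hbar / μ ^ 2) / Fintype.card Λ :=
  LROForcesLowLyingStatesNarrow_holds.min_adjacent_le sys Φ EΛ μ c hΦ hC Ep Em hp hm

end Narrow

end Literature.Barriers.HubbardSuperconductivity

end
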